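import Summits.BirchSwinnertonDyer.BirchSwinnertonDyer.Theorems.ClassRecordThreeEulerHalvesAtThreeCartanCarayolHeckeStable
import Summits.BirchSwinnertonDyer.BirchSwinnertonDyer.Theorems.ClassRecordThreeEulerHalvesAtThreeCartanCarayolDeligneSerrePackage
import HarnessLib

/-!
# A mod-3 Hecke eigen-cochain in `Hom_par(Γ, ℤ)` lifts to a complex joint eigen-cochain
# (glue for (LIFT′) `CartanCarayol.CuspidalEigenCochainLiftPrimeToCartanPlaceAtThree`, cochain side)

Theorems only. For a subgroup `Γ ≤ GL₂(K)` (`char K = 0`) and a family of Hecke data `T ℓ` (`ℓ ∈ P`) on `Γ`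
(`InertHecke.HeckeDatum`, acting on cochains by `HeckeDatum.op`), assume

* (the shape of (SIGᶜ)(i), `Literature.NumberTheory.Automorphic.parabolicCochain_free_and_modLift`) the additive
  parabolic-null integer cochains `u : Γ → ℤ` have a finite `ℤ`-basis `b₁, …, b_r`;
* the operators `T ℓ`, `T ℓ'` (`ℓ, ℓ' ∈ P`) commute on additive parabolic-null integer cochains;
* `ψ : Γ → ZMod 3` is a non-zero simultaneous eigen-cochain, `T ℓ ψ = a ℓ • ψ` (`ℓ ∈ P`), which is the reduction of an additive
  parabolic-null `u : Γ → ℤ` (the output of (SIGᶜ)(ii) fed with `CartanCarayol.exists_zmod_three_cochain_of_package`).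

Then (`exists_eigenCochain_lift_of_eigenCochain_mod_three`) there are an order `R` (a domain, module-finite over `ℤ`), an
embedding `σ : R ↪ ℂ`, a place `φ : R → ℤ/3`, elements `t ℓ ∈ R` and a NON-ZERO additive parabolic-null complex cochain
`v : Γ → ℂ` with `T ℓ v = σ(t ℓ) • v` and `φ(t ℓ) = a ℓ (mod 3)` for all `ℓ ∈ P`. This is
`CartanCarayol.exists_eigenvalueOrder_of_eigenvector_mod_three` ([DeligneSerre1974, Lemme 6.11] on a Hecke-stable lattice)
instantiated with `M = Hom_par(Γ, ℤ)`, `V =` the `ℂ`-span of `M` inside `Γ → ℂ`, `T ℓ` acting through `HeckeDatum.op`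
(`ℂ`-linear; it preserves `M` by `CartanCarayol.heckeOp_parabolicNull` and commutes with the change of coefficients,
`CartanCarayol.heckeOp_comp_addMonoidHom`). What is left for (LIFT′) after this file is analytic: Eichler–Shimura
(`eichlerShimura_weightTwo_rePeriod`) with its Hecke-equivariance turns `v` into an eigenform on the cover curve, and
Jacquet–Langlands (`jacquetLanglands_cartanCover_newform.exists_newform1`) + `exists_maximal_ideal_over_ker` finish.

## References
* [DeligneSerre1974] P. Deligne, J.-P. Serre, *Formes modulaires de poids 1*, Ann. Sci. ÉNS 7 (1974), Lemme 6.11.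
* [ShimuraIATAF1971] G. Shimura, *Introduction to the arithmetic theory of automorphic functions* (1971), § 8.2–§ 8.3.
* [AshStevens1986] A. Ash, G. Stevens, *Modular forms in characteristic ℓ and special values of their L-functions*, Duke Math. J. 53 (1986), § 1.2.
-/

set_option linter.dupNamespace false

noncomputable section

open scoped Classical MatrixGroups

namespace Summit.BirchSwinnertonDyer.BirchSwinnertonDyer.Theorems.CartanCarayol

open Summit.BirchSwinnertonDyer.BirchSwinnertonDyer.Theorems.CartanCover.Charext
open Summit.BirchSwinnertonDyer.BirchSwinnertonDyer.Theorems.CartanCover.Charext.InertHecke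

universe u w

/-! ## § 1 Small lemmas -/

/-- `HeckeDatum.op` is `ℂ`-linear in the cochain. [folklore] -/
theorem heckeOp_add {𝔾 : Type*} [Group 𝔾] {Γ : Subgroup 𝔾} {ι : Type*} [Fintype ι] (H : HeckeDatum Γ ι) {A : Type*} [AddCommGroup A]
    (χ χ' : Γ → A) : H.op (χ + χ') = H.op χ + H.op χ' := by
  funext γ
  simp only [HeckeDatum.op_apply, Pi.add_apply, Finset.sum_add_distrib]

/-- `HeckeDatum.op` commutes with scalars. [folklore] -/
theorem heckeOp_smul {𝔾 : Type*} [Group 𝔾] {Γ : Subgroup 𝔾} {ι : Type*} [Fintype ι] (H : HeckeDatum Γ ι) {S A : Type*} [AddCommGroup A]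
    [DistribSMul S A] (c : S) (χ : Γ → A) : H.op (c • χ) = c • H.op χ := by
  funext γ
  simp only [HeckeDatum.op_apply, Pi.smul_apply, Finset.smul_sum]

/-- a divided cochain: if `3 ∣ x γ` pointwise for an additive parabolic-null `x`, the quotient is additive parabolic-null. [folklore] -/
theorem exists_eq_three_mul_cochain {K : Type u} [Field K] {Γ : Subgroup (GL (Fin 2) K)} (x : Γ → ℤ) (hadd : ∀ γ δ, x (γ * δ) = x γ + x δ)
    (hpar : ∀ γ : Γ, Matrix.GeneralLinearGroup.IsParabolic (γ : GL (Fin 2) K) → x γ = 0) (hdvd : ∀ γ, (3 : ℤ) ∣ x γ) :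
    ∃ w : Γ → ℤ, (∀ γ δ, w (γ * δ) = w γ + w δ) ∧ (∀ γ : Γ, Matrix.GeneralLinearGroup.IsParabolic (γ : GL (Fin 2) K) → w γ = 0) ∧
      ∀ γ, x γ = 3 * w γ := by
  choose w hw using hdvd
  refine ⟨w, fun γ δ ↦ ?_, fun γ hγ ↦ ?_, hw⟩
  · apply mul_left_cancel₀ (three_ne_zero (α := ℤ))
    rw [mul_add, ← hw, ← hw, ← hw, hadd]
  · apply mul_left_cancel₀ (three_ne_zero (α := ℤ))
    rw [← hw, hpar γ hγ, mul_zero]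

/-! ## § 2 The lift -/

variable {K : Type u} [Field K] [CharZero K] {Γ : Subgroup (GL (Fin 2) K)}

/-- **A MOD-3 HECKE EIGEN-COCHAIN IN `Hom_par(Γ, ℤ)` LIFTS TO A COMPLEX JOINT EIGEN-COCHAIN** with eigenvalues in an order `R ↪ ℂ` reducing, at a place
`φ : R → ℤ/3`, to the given ones. Hypotheses: a finite `ℤ`-basis of the additive parabolic-null integer cochains ((SIGᶜ)(i)); commutation of the `T ℓ`,
`ℓ ∈ P`, on those cochains; a non-zero eigen-cochain `ψ : Γ → ZMod 3` with an additive parabolic-null integral lift `u` ((SIGᶜ)(ii)).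
[DeligneSerre1974, Lemme 6.11] via `exists_eigenvalueOrder_of_eigenvector_mod_three` [folklore: assembly]. -/
theorem exists_eigenCochain_lift_of_eigenCochain_mod_three
    {P : Set ℕ} {ι : ℕ → Type w} [∀ ℓ, Fintype (ι ℓ)] (T : ∀ ℓ, HeckeDatum Γ (ι ℓ))
    {r : ℕ} (b : Fin r → (Γ → ℤ)) (hbadd : ∀ i γ δ, b i (γ * δ) = b i γ + b i δ)
    (hbpar : ∀ i, ∀ γ : Γ, Matrix.GeneralLinearGroup.IsParabolic (γ : GL (Fin 2) K) → b i γ = 0)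
    (huniq : ∀ x : Γ → ℤ, (∀ γ δ, x (γ * δ) = x γ + x δ) → (∀ γ : Γ, Matrix.GeneralLinearGroup.IsParabolic (γ : GL (Fin 2) K) → x γ = 0) →
      ∃! c : Fin r → ℤ, x = fun γ ↦ ∑ i, c i * b i γ)
    (hcomm : ∀ ℓ ∈ P, ∀ ℓ' ∈ P, ∀ x : Γ → ℤ, (∀ γ δ, x (γ * δ) = x γ + x δ) →
      (∀ γ : Γ, Matrix.GeneralLinearGroup.IsParabolic (γ : GL (Fin 2) K) → x γ = 0) → (T ℓ).op ((T ℓ').op x) = (T ℓ').op ((T ℓ).op x))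
    (a : ℕ → ℤ) (ψ : Γ → ZMod 3) (hψne : ∃ γ, ψ γ ≠ 0) (hψeig : ∀ ℓ ∈ P, ∀ γ, (T ℓ).op ψ γ = a ℓ • ψ γ)
    (u : Γ → ℤ) (huadd : ∀ γ δ, u (γ * δ) = u γ + u δ) (hupar : ∀ γ : Γ, Matrix.GeneralLinearGroup.IsParabolic (γ : GL (Fin 2) K) → u γ = 0)
    (hu : ∀ γ, (u γ : ZMod 3) = ψ γ) :
    ∃ (R : Type u) (_ : CommRing R) (_ : IsDomain R) (_ : Module.Finite ℤ R) (σ : R →+* ℂ) (φ : R →+* ℤ ⧸ (Ideal.span {(3 : ℤ)} : Ideal ℤ))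
      (t : ℕ → R) (v : Γ → ℂ), Function.Injective σ ∧ v ≠ 0 ∧ (∀ γ δ, v (γ * δ) = v γ + v δ) ∧
      (∀ γ : Γ, Matrix.GeneralLinearGroup.IsParabolic (γ : GL (Fin 2) K) → v γ = 0) ∧
      (∀ ℓ ∈ P, (T ℓ).op v = σ (t ℓ) • v) ∧ ∀ ℓ ∈ P, φ (t ℓ) = Ideal.Quotient.mk _ (a ℓ) := by
  classical
  -- § the lattice `M = Hom_par(Γ, ℤ)`
  let M : Submodule ℤ (Γ → ℤ) :=
    { carrier := {x | (∀ γ δ, x (γ * δ) = x γ + x δ) ∧ ∀ γ : Γ, Matrix.GeneralLinearGroup.IsParabolic (γ : GL (Fin 2) K) → x γ = 0}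
      add_mem' := fun {x y} hx hy ↦ ⟨fun γ δ ↦ by simp only [Pi.add_apply, hx.1, hy.1]; abel,
        fun γ hγ ↦ by simp only [Pi.add_apply, hx.2 γ hγ, hy.2 γ hγ, add_zero]⟩
      zero_mem' := ⟨fun γ δ ↦ by simp, fun γ _ ↦ rfl⟩
      smul_mem' := fun c {x} hx ↦ ⟨fun γ δ ↦ by simp only [Pi.smul_apply, smul_eq_mul, hx.1, mul_add],
        fun γ hγ ↦ by simp only [Pi.smul_apply, smul_eq_mul, hx.2 γ hγ, mul_zero]⟩ }
  have hMadd : ∀ x : M, ∀ γ δ, (x : Γ → ℤ) (γ * δ) = (x : Γ → ℤ) γ + (x : Γ → ℤ) δ := fun x ↦ x.2.1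
  have hMpar : ∀ x : M, ∀ γ : Γ, Matrix.GeneralLinearGroup.IsParabolic (γ : GL (Fin 2) K) → (x : Γ → ℤ) γ = 0 := fun x ↦ x.2.2
  let bM : Fin r → M := fun i ↦ ⟨b i, hbadd i, hbpar i⟩
  have hcoord : ∀ (c : Fin r → ℤ) (γ : Γ), ((∑ i, c i • bM i : M) : Γ → ℤ) γ = ∑ i, c i * b i γ := fun c γ ↦ by
    rw [Submodule.coe_sum, Finset.sum_apply]
    exact Finset.sum_congr rfl fun i _ ↦ by rw [Submodule.coe_smul, Pi.smul_apply, smul_eq_mul]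
  have hli : LinearIndependent ℤ bM := by
    rw [Fintype.linearIndependent_iff]
    intro g hg i
    have h0 : (0 : Γ → ℤ) = fun γ ↦ ∑ i, g i * b i γ := by
      funext γ; rw [← hcoord, hg]; rfl
    have h0' : (0 : Γ → ℤ) = fun γ ↦ ∑ i, (0 : Fin r → ℤ) i * b i γ := by funext γ; simp
    have := (huniq 0 (fun _ _ ↦ by simp) (fun _ _ ↦ rfl)).unique h0 h0'
    exact congrFun this i
  have hsp : ⊤ ≤ Submodule.span ℤ (Set.range bM) := fun x _ ↦ by
    obtain ⟨c, hc, -⟩ := huniq x (hMadd x) (hMpar x)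
    have ex : x = ∑ i, c i • bM i := Subtype.ext (by rw [hc]; funext γ; rw [hcoord])
    rw [ex]
    exact Submodule.sum_mem _ fun i _ ↦ Submodule.smul_mem _ _ (Submodule.subset_span ⟨i, rfl⟩)
  let basis : Module.Basis (Fin r) ℤ M := Module.Basis.mk hli hsp
  haveI : Module.Free ℤ M := Module.Free.of_basis basis
  haveI : Module.Finite ℤ M := Module.Finite.of_basis basis
  -- § complexification `e : M → V := ℂ·M ⊆ (Γ → ℂ)`
  let e₀ : M →+ (Γ → ℂ) :=
    { toFun := fun x γ ↦ ((x : Γ → ℤ) γ : ℂ)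
      map_zero' := by funext γ; simp
      map_add' := fun x y ↦ by funext γ; simp }
  have he₀ : ∀ (x : M) (γ : Γ), e₀ x γ = ((x : Γ → ℤ) γ : ℂ) := fun _ _ ↦ rfl
  set V : Submodule ℂ (Γ → ℂ) := Submodule.span ℂ (Set.range e₀) with hV
  let e : M →+ V :=
    { toFun := fun x ↦ ⟨e₀ x, Submodule.subset_span ⟨x, rfl⟩⟩
      map_zero' := Subtype.ext (map_zero e₀)
      map_add' := fun x y ↦ Subtype.ext (map_add e₀ x y) }
  have he_coe : ∀ x : M, ((e x : V) : Γ → ℂ) = e₀ x := fun _ ↦ rfl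
  have he : Function.Injective e := fun x y hxy ↦ by
    apply Subtype.ext; funext γ
    have := congrFun (congrArg Subtype.val hxy) γ
    rw [he_coe, he_coe, he₀, he₀] at this
    exact_mod_cast this
  have hspan : Submodule.span ℂ (Set.range e) = ⊤ := by
    have h1 : Set.range e = Subtype.val ⁻¹' Set.range e₀ := by
      ext ⟨y, hy⟩
      constructor
      · rintro ⟨x, hx⟩; exact ⟨x, congrArg Subtype.val hx⟩
      · rintro ⟨x, hx⟩; exact ⟨x, Subtype.ext hx⟩
    rw [h1]
    exact Submodule.span_span_coe_preimage
  have hVle : V ≤ Submodule.span ℂ (Set.range fun i ↦ e₀ (bM i)) := by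
    rw [hV, Submodule.span_le]
    rintro _ ⟨x, rfl⟩
    obtain ⟨c, hc, -⟩ := huniq x (hMadd x) (hMpar x)
    have ex : e₀ x = ∑ i, (c i : ℂ) • e₀ (bM i) := by
      funext γ
      rw [he₀, hc, Finset.sum_apply]
      push_cast
      exact Finset.sum_congr rfl fun i _ ↦ by rw [Pi.smul_apply, he₀, smul_eq_mul]
    rw [SetLike.mem_coe, ex]
    exact Submodule.sum_mem _ fun i _ ↦ Submodule.smul_mem _ _ (Submodule.subset_span ⟨i, rfl⟩)
  haveI : FiniteDimensional ℂ (Submodule.span ℂ (Set.range fun i ↦ e₀ (bM i))) := FiniteDimensional.span_of_finite ℂ (Set.finite_range _)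
  haveI : FiniteDimensional ℂ V := Submodule.finiteDimensional_of_le hVle
  -- § the operators `T ℓ` on `V`, through `HeckeDatum.op`
  let T₀ : ℕ → Module.End ℂ (Γ → ℂ) := fun ℓ ↦
    { toFun := (T ℓ).op
      map_add' := heckeOp_add (T ℓ)
      map_smul' := fun c χ ↦ heckeOp_smul (T ℓ) c χ }
  have hT₀ : ∀ ℓ (χ : Γ → ℂ), T₀ ℓ χ = (T ℓ).op χ := fun _ _ ↦ rfl
  let TM : ℕ → M → M := fun ℓ x ↦ ⟨(T ℓ).op (x : Γ → ℤ), heckeOp_parabolicNull (T ℓ) _ (hMadd x) (hMpar x)⟩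
  have hTM : ∀ ℓ (x : M), ((TM ℓ x : M) : Γ → ℤ) = (T ℓ).op (x : Γ → ℤ) := fun _ _ ↦ rfl
  have he₀T : ∀ ℓ (x : M), T₀ ℓ (e₀ x) = e₀ (TM ℓ x) := fun ℓ x ↦ by
    funext γ
    rw [hT₀, he₀, hTM]
    exact heckeOp_comp_addMonoidHom (T ℓ) (Int.castAddHom ℂ) (x : Γ → ℤ) γ
  have hVstab : ∀ ℓ, ∀ y ∈ V, T₀ ℓ y ∈ V := fun ℓ ↦ by
    have hle : V ≤ V.comap (T₀ ℓ) := by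
      rw [hV, Submodule.span_le]
      rintro _ ⟨x, rfl⟩
      rw [SetLike.mem_coe, Submodule.mem_comap, he₀T]
      exact Submodule.subset_span ⟨TM ℓ x, rfl⟩
    exact fun y hy ↦ hle hy
  let T' : ℕ → Module.End ℂ V := fun ℓ ↦ (T₀ ℓ).restrict (hVstab ℓ)
  have hT'e : ∀ ℓ (x : M), T' ℓ (e x) = e (TM ℓ x) := fun ℓ x ↦ Subtype.ext (by rw [LinearMap.coe_restrict_apply, he_coe, he_coe, he₀T])
  have hstab' : ∀ ℓ ∈ P, ∀ x : M, ∃ y : M, T' ℓ (e x) = e y := fun ℓ _ x ↦ ⟨TM ℓ x, hT'e ℓ x⟩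
  have hc' : ∀ ℓ ∈ P, ∀ ℓ' ∈ P, Commute (T' ℓ) (T' ℓ') := fun ℓ hℓ ℓ' hℓ' ↦ by
    refine LinearMap.ext_on hspan ?_
    rintro _ ⟨x, rfl⟩
    rw [Module.End.mul_apply, Module.End.mul_apply, hT'e, hT'e, hT'e, hT'e]
    congr 1
    exact Subtype.ext (hcomm ℓ hℓ ℓ' hℓ' _ (hMadd x) (hMpar x))
  -- § the vector `u` and its mod-3 eigen-property
  let uM : M := ⟨u, huadd, hupar⟩
  have hf : ∀ x : M, uM ≠ (3 : ℤ) • x := fun x hx ↦ by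
    obtain ⟨γ, hγ⟩ := hψne
    apply hγ
    have : u γ = 3 * (x : Γ → ℤ) γ := by
      have := congrFun (congrArg Subtype.val hx) γ
      simpa [uM] using this
    rw [← hu, this]
    push_cast
    rw [show (3 : ZMod 3) = 0 from by decide, zero_mul]
  have heig' : ∀ ℓ ∈ P, ∃ x : M, T' ℓ (e uM) = e (a ℓ • uM + (3 : ℤ) • x) := fun ℓ hℓ ↦ by
    have hψu : ψ = (Int.castAddHom (ZMod 3) : ℤ →+ ZMod 3) ∘ u := funext fun γ ↦ (hu γ).symm
    have hdvd : ∀ γ, (3 : ℤ) ∣ ((T ℓ).op u - a ℓ • u) γ := fun γ ↦ by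
      have h1 := hψeig ℓ hℓ γ
      rw [hψu, heckeOp_comp_addMonoidHom, Function.comp_apply, Int.coe_castAddHom, zsmul_eq_mul, ← Int.cast_mul] at h1
      have h2 := (ZMod.intCast_eq_intCast_iff_dvd_sub _ _ 3).mp h1.symm
      rw [Pi.sub_apply, Pi.smul_apply, smul_eq_mul]
      simpa using h2
    obtain ⟨w, hwadd, hwpar, hw⟩ := exists_eq_three_mul_cochain ((T ℓ).op u - a ℓ • u)
      (fun γ δ ↦ by
        rw [Pi.sub_apply, Pi.sub_apply, Pi.sub_apply, (T ℓ).op_mul u huadd, Pi.smul_apply, Pi.smul_apply, Pi.smul_apply, huadd]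
        simp only [smul_eq_mul]; ring)
      (fun γ hγ ↦ by rw [Pi.sub_apply, Pi.smul_apply, heckeOp_apply_eq_zero_of_isParabolic (T ℓ) u huadd hupar γ hγ, hupar γ hγ, smul_zero, sub_zero]) hdvd
    refine ⟨⟨w, hwadd, hwpar⟩, ?_⟩
    rw [hT'e]
    congr 1
    apply Subtype.ext
    funext γ
    have := hw γ
    rw [Pi.sub_apply, Pi.smul_apply, smul_eq_mul, sub_eq_iff_eq_add'] at this
    rw [hTM, Submodule.coe_add, Submodule.coe_smul, Submodule.coe_smul, Pi.add_apply, Pi.smul_apply, Pi.smul_apply, smul_eq_mul, smul_eq_mul]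
    exact this
  -- § the package
  obtain ⟨R, _, _, _, σ, φ, t, v, hσ, hv0, hTv, hφ⟩ :=
    exists_eigenvalueOrder_of_eigenvector_mod_three P T' hc' e he hspan hstab' a uM hf heig'
  -- § unbundle
  have hVadd : ∀ y ∈ V, (∀ γ δ, (y : Γ → ℂ) (γ * δ) = y γ + y δ) ∧ ∀ γ : Γ, Matrix.GeneralLinearGroup.IsParabolic (γ : GL (Fin 2) K) → y γ = 0 := by
    intro y hy
    induction hy using Submodule.span_induction with
    | mem _ hx =>
      obtain ⟨x, rfl⟩ := hx
      exact ⟨fun γ δ ↦ by rw [he₀, he₀, he₀, hMadd]; push_cast; rfl, fun γ hγ ↦ by rw [he₀, hMpar x γ hγ]; simp⟩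
    | zero => exact ⟨fun _ _ ↦ by simp, fun _ _ ↦ rfl⟩
    | add y z _ _ hy hz => exact ⟨fun γ δ ↦ by simp only [Pi.add_apply, hy.1, hz.1]; abel, fun γ hγ ↦ by simp [hy.2 γ hγ, hz.2 γ hγ]⟩
    | smul c y _ hy => exact ⟨fun γ δ ↦ by simp only [Pi.smul_apply, hy.1, smul_add], fun γ hγ ↦ by simp [hy.2 γ hγ]⟩
  refine ⟨R, ‹_›, ‹_›, ‹_›, σ, φ, t, (v : Γ → ℂ), hσ, fun h0 ↦ hv0 (Subtype.ext h0), (hVadd v v.2).1, (hVadd v v.2).2, fun ℓ hℓ ↦ ?_, hφ⟩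
  have := congrArg Subtype.val (hTv ℓ hℓ)
  rw [LinearMap.coe_restrict_apply, hT₀, Submodule.coe_smul] at this
  exact this

end Summit.BirchSwinnertonDyer.BirchSwinnertonDyer.Theorems.CartanCarayol

end
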